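/-
Copyright: cell `pub-ymgap` (HUMAN RULING D-0062), Track A of `YM-PLAN.md`, DAG node N20 (= NE7b); R134 acceleration seat
`pub-ymgap-dag-n20-c` (strategy s1, generation 11), module 56.  Released under the licence of the surrounding project.
-/
import Summits.QuantumFields.YangMills.Theorems.BalabanUVNodesN20LCSDatumAllLayers
import HarnessLib

/-!
# YM-DAG node N20 (= NE7b), row s1, module 56: THE K0 SOCKET — (T♭) from ONE sentence in NODE 00's own grammar, «[15] Theorem 1 (R) at the top scale
# for def-R's χ-CLASS local problems» (T♯); the instance and the named Props modulo (W♮) + (T♯)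

Track A of `YM-PLAN.md` (cell `pub-ymgap`, HUMAN RULING D-0062), node **N20** = spine estimate NE7b (`T4WeightBudget.RelWeightBound`, NOT PRINTED, NOT
PROVED).  Seat `pub-ymgap-dag-n20-c` (R134, s1), generation 11, module 56 (imports module 55 `…N20LCSDatumAllLayers`).

WHY.  Module 55 displays the row's instance modulo (W♮) + (T♭), (T♭) = «every minimiser of def-R's (2.16) χ-problem at `□_c^{∼4}` whose datum `M˙(Q*V')` is
`ε″`-small at every layer inside `□^{∼4}` is `B·ε″·η²`-small on `{p ⊂ □_c^∼}`».  NODE 00's [15]-facts (`VariationalThm1RegSepTop7M ∕ …CoP7M`, def-P11) speak a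
fixed grammar: datum `W` with `Sect2.DataSmall7PTop av Ω (Sup …) k δ W`, minimisers over a class with determining set `genSet Ω k`, conclusion
`PlaqSmallOn (Sect2.omegaPlaqsTop Ω (Sup …) n) (B₃·δ_n·η_n²)`.  THIS MODULE states (T♭)'s supplier IN THAT GRAMMAR — (T♯): at the local maximal sequence
`Ω := maxDomT ν.M₁ (□_c^{∼4})` (so `genSet Ω (j+1) = 𝐁_{j+1}(□_c^{∼4})`, r11's `Bj`, definitionally), `Sup := suppDomOfRecord`, class := def-R's v1 χ-class
`{PlaqSmall (εreg·η_{j+1}²)}`, top scale `n = j+1` only — and proves (T♯) ⇒ (T♭) by one application: the all-layer premise of (T♭) IS the (7) predicate for the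
consistent datum `M˙(Q*V')` (§2: print's mixed field of consistent data is the datum itself, dag-n12-c's `mixedField_avgFamily`; the (7) ranges of the local
sequence lie inside `□^{∼4}`, dag-n12-c §8), and `{p ⊂ □_c^∼}` are plaquettes meeting the top domain `Ω_{j+1}(□_c^{∼4})` because `□^{∼1} ⊆ Ω_{j+1}(□^{∼4})`
(§1: print's «Ω^{∼−2} ⊂ Ω_j», r11's `image_innerN_two_subset_maxDomT`, under `L^{j+1}M₁ ≤ sideχ_j = L^{j+2}M₂R_{j+1}`; dag-n21's `…N21ChiSlotCubeGeometry`
(G2)∕(G3) are the level-`1` twins, not imported here — N21 chain).  So the residual (T) of the N20 s1 row is now ONE SENTENCE OF NODE 00's GRAMMAR whose only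
non-print ingredient is def-R's v1 χ-CLASS (H0): a K0 fact `VariationalThm1…` stated for that class at arbitrary (2.13) sequences discharges `hχ` below by
instantiation (its numerics premises — `0 < ε″ ≤ a₁`, `B₃ε″ ≤ εreg ≤ a₀` — are the regime's, `ε″ = ε(g_{j+1})∕B₃`).

CONTENTS.  §1 `cubeExt_one_subset_innerN_cover`, ★ `cubeEnl_one_subset_maxDomT_top` (`□^{∼1} ⊆ Ω_k(□^{∼4})` for `LᵏM₁ ≤ s`, `M₁ ≥ 1`).  §2 ★
`dataSmall7PTop_of_allLayers` (consistent data: all-layer smallness inside `Y` ⇒ `Sect2.DataSmall7PTop … (maxDomT ν.M₁ Y) Ω₀ …` for any top domain whose level-0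
range lies in `Y`; letters `M₁ ≥ 2`, `LᵏM₁ ∣ 2L^{m+K}`).  §3 ★★★ `hThm1'_of_chiClassLocal` ((T♯) ⇒ (T♭), thresholds `ε″_j` ∕ `B·ε″_j·η²`), `hχ_of_le` (A2: (T♯) holds with premise unused when `εreg ≤ B·ε″`).  §4 ★★★
`sum_admS_integral_le_rec_pinnedLevels_of_le_gstar_chiClassLocal` (module 55∕53 modulo (W♮)+(T♯)), ★★★ `halves_of_le_gstar_of_any_chiClassLocal` (module 55∕54's
named Props modulo (W♮)+(T♯)).  No `def`, no `instance`, no `sorry`; axioms standard.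

HONEST FRAMING.  Count-neutral kernel bookkeeping (the residual re-stated in the supplier's grammar + two geometric lemmas); (T♯) is NOT a tree fact and is NOT
print's theorem verbatim (the CLASS is def-R's v1 χ-class, print's is the scale-dependent class (2)∕(6) with co-divergence — H0, def-R∕K0's); (W♮) («LCS-j on
the hull», (A1c)) untouched — THE wall; N20 NOT discharged; (α)-instance 0∕1; nothing continuum ∕ ℝ⁴ ∕ OS ∕ mass-gap ∕ Clay.
-/

noncomputable section

open scoped BigOperators ENNReal

namespace Summit.QuantumFields.YangMills.BalabanUVNodes.N20LCSChiClassSocket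

open Literature.MathematicalPhysics.QuantumFieldTheory.Balaban1983to89
open Literature.MathematicalPhysics.QuantumFieldTheory.Balaban1983to89.T4Continuum
open Literature.MathematicalPhysics.QuantumFieldTheory.Balaban1983to89.Node00
open B15DeterminingSets B14.Eq213DetSet B14.Eq216Concrete B14.Eq213MaximalDomains B15Eq112TorusCover B14DomainGeom B15LatticeCubeTorus
open Literature.MathematicalPhysics.QuantumFieldTheory.BalabanImbrieJaffe1984to88.BIJ85Eq453GaugeField (qsstarGIter0)
open Literature.MathematicalPhysics.QuantumFieldTheory.Balaban1983to89.B14.Eq218Concrete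
open B15Prop1Carrier (plaqsInside)
open ExpMeanLog (deltaSU)
open MeasureTheory
open Summit.QuantumFields.BalabanUV.T4Continuum.B16HistoryIndexedRepr (GoodClass)
open Summit.QuantumFields.BalabanUV.T4Continuum.B16HistoryReprChain
open Summit.QuantumFields.BalabanUV.T4Continuum.NE7b.PrefixExtraction (admS)
open Summit.QuantumFields.BalabanUV.T4Continuum.NE7b.LocalConditionalStability (LocCondStability PointwiseExtraction)
open Summit.QuantumFields.YangMills.BalabanUVNodes.N20LCSLabelTower
open Summit.QuantumFields.YangMills.BalabanUVNodes.N20LCSAvgDominationRegion (boxRegion)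
open Summit.QuantumFields.YangMills.BalabanUVNodes.N20LCSDatumAllLayers (sum_admS_integral_le_rec_pinnedLevels_of_le_gstar_allLayers halves_of_le_gstar_of_any_allLayers)

/-! ## §1  `□^{∼1} ⊆ Ω_k(□^{∼4})`: the cube's neighbourhood lies in the top maximal domain of the local (2.13) sequence -/

section Geometry

variable {P : Params}

/-- **THE 1-COLLAR LIES TWO `t`-LAYERS INSIDE THE 4-COLLAR** on the cover: if `0 < t ≤ s`, every point within two `t`-cubes (each direction) of a point of the box
`cubeExt s a s` lies in the box `cubeExt s a (4s)`, so the 1-collar lies in `innerN t 2` of the pull-back of the 4-collar (dag-n21's `cubeExt_one_subset_innerN_two`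
in `…N21ChiSlotCubeGeometry` is the same over an arbitrary superset; not imported — N21 chain). [folklore] -/
theorem cubeExt_one_subset_innerN_cover {t s : ℕ} (ht : 0 < t) (hts : t ≤ s) (a : Pt P.d) :
    cubeExt s a (s : ℤ) ⊆ innerN t 2 (cover P ⁻¹' cubeEnl P s a 4) := by
  intro x hx
  have ht' : (0 : ℤ) < t := by exact_mod_cast ht
  have hts' : (t : ℤ) ≤ s := by exact_mod_cast hts
  have hbox : ∀ y : Pt P.d, (∀ i, |cubeIdx t x i - cubeIdx t y i| ≤ 2) → y ∈ cubeExt s a ((4 * s : ℕ) : ℤ) := by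
    intro y hy i
    have h1 := cubeIdx_le t ht x i
    have h2 := lt_cubeIdx t ht x i
    have h3 := cubeIdx_le t ht y i
    have h4 := lt_cubeIdx t ht y i
    have h5 := abs_le.1 (hy i)
    obtain ⟨hx1, hx2⟩ := hx i
    have h6 : (t : ℤ) * cubeIdx t y i ≥ (t : ℤ) * (cubeIdx t x i - 2) := mul_le_mul_of_nonneg_left (by linarith [h5.1, h5.2]) ht'.le
    have h7 : (t : ℤ) * cubeIdx t y i ≤ (t : ℤ) * (cubeIdx t x i + 2) := mul_le_mul_of_nonneg_left (by linarith [h5.1, h5.2]) ht'.le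
    push_cast
    constructor <;> nlinarith
  refine ⟨⟨x, fun i => ⟨by have := (hx i).1; push_cast; linarith [(Nat.cast_nonneg s : (0:ℤ) ≤ s)], by have := (hx i).2; push_cast; nlinarith⟩, rfl⟩, fun y hy => ⟨y, hbox y hy, rfl⟩⟩

/-- ★ **`□^{∼1} ⊆ Ω_k(□^{∼4})`**: the 1-collar `cubeEnl P s a 1` of an `s`-cube lies in the `k`-th (top) maximal domain of the (2.13) sequence of its 4-collar
`cubeEnl P s a 4` whenever the layer width `LᵏM₁ ≤ s` (`M₁ ≥ 1`) — print's *«Ω^{∼−2} ⊂ Ω_j»* (r11's `image_innerN_two_subset_maxDomT`) applied to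
`□^{∼1} ⊆ (□^{∼4})^{∼−2}`.  At the χ_{k}-cubes (`s = L^{k+1}M₂R_k`) the letter reads `M₁ ≤ L·M₂·R_k`. [cite: Balaban1988Convergent, (2.13) pp.256–257, (2.16)–(2.17) p.257] -/
theorem cubeEnl_one_subset_maxDomT_top {M₁ : ℕ} (hM : 1 ≤ M₁) {k s : ℕ} (hts : side P.L M₁ k ≤ s) (a : Pt P.d) :
    cubeEnl P s a 1 ⊆ maxDomT M₁ (cubeEnl P s a 4) k := by
  have ht : 0 < side P.L M₁ k := side_pos P.L_pos hM k
  have h1 : cubeEnl P s a 1 ⊆ cover P '' innerN (side P.L M₁ k) 2 (cover P ⁻¹' cubeEnl P s a 4) := by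
    rintro _ ⟨x, hx, rfl⟩
    refine ⟨x, cubeExt_one_subset_innerN_cover ht hts a ?_, rfl⟩
    simpa using hx
  exact h1.trans (image_innerN_two_subset_maxDomT hM _ k)

end Geometry

/-! ## §2  Consistent data: all-layer smallness inside `□^{∼4}` gives NODE 00's `Sect2.DataSmall7PTop` along the local sequence -/

section Consistent

variable (F : T4Family) (N : ℕ) [NeZero N] (ν : Stage7Numerics) (p : B12.RunParams) (g : ℕ → ℝ)

/-- ★ **(T♭)'s ALL-LAYER PREMISE ⇒ NODE 00's (7) PREDICATE** for CONSISTENT data `W = M˙(U)` (the datum of record `M˙(Q*V')` is of this form): if every layer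
`W i`, `i ≤ k`, is `δ`-small on the plaquettes inside `Y^{(i)}`, `Y = □_c^{∼4}`, then `Sect2.DataSmall7PTop avOfRecord (maxDomT ν.M₁ Y) Ω₀ k (fun _ ↦ δ) W` for every top
domain `Ω₀` whose level-`0` range lies inside `Y` — level `0` directly, level `m+1` because print's MIXED field of consistent data IS `W (m+1)` (dag-n12-c's
`mixedField_avgFamily`) and the (7) range at level `m+1` lies inside `Y^{(m+1)}` (dag-n12-c's `printedPlaqs_maxDomT_subset_plaqsInside`; print's `M₁ ≥ 2`, torus
divisibility `LᵏM₁ ∣ 2L^{m+K}`). [cite: Balaban1985Variational, (7) p.278 L20–33; Balaban1988Convergent, (2.11) p.256, (2.13) pp.256–257] -/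
theorem dataSmall7PTop_of_allLayers (hM₁ : 2 ≤ ν.M₁) {K k : ℕ} (hdiv : side (F.P K).L ν.M₁ k ∣ (F.P K).sitesPerDir 0)
    {Y Ω₀ : Set (Site (F.P K) 0)} (hΩ₀ : Sect2.printedPlaqsTop (maxDomT ν.M₁ Y) Ω₀ k ⊆ B15Prop1Carrier.plaqsInside Y)
    {δ : ℝ} (U : GaugeField (F.P K) 0 (SU N))
    (hall : ∀ i, i ≤ k → PlaqSmallOn (B15Prop1Carrier.plaqsInside (pts i Y)) δ (avgFamily (avOfRecord F N K) U i)) :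
    Sect2.DataSmall7PTop (avOfRecord F N K) (maxDomT ν.M₁ Y) Ω₀ k (fun _ => δ) (avgFamily (avOfRecord F N K) U) := by
  refine ⟨fun q hq => hall 0 (Nat.zero_le _) q (by simpa [pts_zero] using hΩ₀ hq), fun m hm => ?_⟩
  rw [B15Prop1DatumSmall7AtZSequence.mixedField_avgFamily]
  exact fun q hq => hall (m + 1) hm q
    (B15Prop1DatumSmall7AtZSequence.printedPlaqs_maxDomT_subset_plaqsInside hM₁ hdiv k (by omega) hm hq)

end Consistent

/-! ## §3  THE K0 SOCKET: (T♭) from «[15] Thm 1 (R), top scale, for def-R's χ-CLASS local problems» in NODE 00's grammar, by one application -/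

section Socket

variable (F : T4Family) (N : ℕ) [NeZero N] (ν : Stage7Numerics) (p : B12.RunParams) (g : ℕ → ℝ)

/-- ★★★ **THE K0 SOCKET FOR (T♭)**: if, at every χ_{j+1}-cube `c` of a pinned level `j`, «[15] Theorem 1 (R) AT THE TOP SCALE FOR def-R's χ-CLASS LOCAL PROBLEM» holds
in NODE 00's grammar — datum `W` with `Sect2.DataSmall7PTop avOfRecord (maxDomT ν.M₁ □_c^{∼4}) (suppDomOfRecord …) (j+1) (fun _ ↦ ε″_j) W`, every minimiser `U₀` over
`{PlaqSmall (εreg·η_{j+1}²)}` with determining set `genSet (maxDomT ν.M₁ □_c^{∼4}) (j+1) = 𝐁_{j+1}(□_c^{∼4})` is `B·ε″_j·η_{j+1}²`-small on the plaquettes meeting the top domain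
`Ω_{j+1}(□_c^{∼4})` (`Sect2.omegaPlaqsTop … (j+1)`) — then (T♭) (module 55's `hThm1'` shape, thresholds `ε″_j` ∕ `B·ε″_j·η²`) holds: the all-layer premise gives the (7)
predicate (§2, consistent datum `M˙(Q*V')`), and `{p ⊂ □_c^∼}` are plaquettes meeting `Ω_{j+1}(□_c^{∼4})` since `□^{∼1} ⊆ Ω_{j+1}(□^{∼4})` (§1; letter `L^{j+1}M₁ ≤ sideχ`,
i.e. `M₁ ≤ L·M₂·R_{j+1}`).  Letters: print's `M₁ ≥ 2`, torus divisibility `L^{j+1}M₁ ∣ 2L^{m+K}`, `L^{j+1}M₁ ≤ L^{j+2}M₂R_{j+1}`.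
[cite: Balaban1985Variational, (7) p.278, Thm 1 (8) p.279; Balaban1988Convergent, (2.12)–(2.13) pp.256–257, (2.16)–(2.17) p.257] -/
theorem hThm1'_of_chiClassLocal (hM₁ : 2 ≤ ν.M₁) (J : Finset ℕ)
    (hdiv : ∀ j ∈ J, side (F.P p.K).L ν.M₁ (j + 1) ∣ (F.P p.K).sitesPerDir 0)
    (hsz : ∀ j ∈ J, side (F.P p.K).L ν.M₁ (j + 1) ≤ sideχ F ν p g j)
    {ε'' : ℕ → ℝ} {B : ℝ}
    (hχ : ∀ j ∈ J, ∀ (c : Iχ F ν p g j) (W : MSField (F.P p.K) (SU N)),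
      Sect2.DataSmall7PTop (avOfRecord F N p.K) (maxDomT ν.M₁ (cubeEnl (F.P p.K) (sideχ F ν p g j) c 4))
          (suppDomOfRecord F ν p.K (maxDomT ν.M₁ (cubeEnl (F.P p.K) (sideχ F ν p g j) c 4))) (j + 1) (fun _ => ε'' j) W →
      ∀ U₀ : GaugeField (F.P p.K) 0 (SU N),
        IsMinimizer (avOfRecord F N p.K) {U | PlaqSmall (ν.εreg * (F.P p.K).eta (j + 1) ^ 2) U}
            (genSet (maxDomT ν.M₁ (cubeEnl (F.P p.K) (sideχ F ν p g j) c 4)) (j + 1)) W U₀ →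
        PlaqSmallOn (Sect2.omegaPlaqsTop (maxDomT ν.M₁ (cubeEnl (F.P p.K) (sideχ F ν p g j) c 4))
            (suppDomOfRecord F ν p.K (maxDomT ν.M₁ (cubeEnl (F.P p.K) (sideχ F ν p g j) c 4))) (j + 1))
          (B * ε'' j * (F.P p.K).eta (j + 1) ^ 2) U₀) :
    ∀ j ∈ J, ∀ (c : Iχ F ν p g j) (V' : GaugeField (F.P p.K) (j + 1) (SU N)) (U₀ : GaugeField (F.P p.K) 0 (SU N)),
      IsMinimizer (avOfRecord F N p.K) {U | PlaqSmall (ν.εreg * (F.P p.K).eta (j + 1) ^ 2) U}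
          (Bj ν.M₁ (cubeEnl (F.P p.K) (sideχ F ν p g j) c 4) (j + 1)) (avgFamily (avOfRecord F N p.K) (qsstarGIter0 (j + 1) V')) U₀ →
      (∀ i, i ≤ j + 1 → PlaqSmallOn (B15Prop1Carrier.plaqsInside (pts i (cubeEnl (F.P p.K) (sideχ F ν p g j) c 4))) (ε'' j)
        (avgFamily (avOfRecord F N p.K) (qsstarGIter0 (j + 1) V') i)) →
      PlaqSmallOn (plaqInside (cubeEnl (F.P p.K) (sideχ F ν p g j) c 1)) (B * ε'' j * (F.P p.K).eta (j + 1) ^ 2) U₀ := by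
  intro j hj c V' U₀ hmin hall
  have hM1 : 1 ≤ ν.M₁ := le_trans (by norm_num) hM₁
  have h7 := dataSmall7PTop_of_allLayers F N ν hM₁ (hdiv j hj)
    (B15Prop1DatumSmall7AtZSequence.printedPlaqsTop_maxDomT_subset_plaqsInside hM1 (hdiv j hj) (by omega) (j + 1))
    (qsstarGIter0 (j + 1) V') hall
  have h8 := hχ j hj c _ h7 U₀ hmin
  rw [Sect2.omegaPlaqsTop, if_neg (Nat.succ_ne_zero j)] at h8
  exact fun q hq => h8 q (B8Eq17ClassAkV1.plaqsOf_mono (cubeEnl_one_subset_maxDomT_top hM1 (hsz j hj) _) (plaqInside_subset_plaqsOf _ hq))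

/-- A2 for (T♯): in the degenerate regime `εreg ≤ B·ε″` every minimiser over def-R's class `{PlaqSmall (εreg·η²)}` is already `B·ε″·η²`-small on EVERY plaquette, so the
socket sentence holds at every cube with its (7) premise UNUSED (module 49 §3 ∕ 55's witnesses, verbatim). [cite: Balaban1988Convergent, (2.12) p.256, (2.17) p.257 (bookkeeping)] -/
theorem hχ_of_le {k : ℕ} {ε'' B : ℝ} (hle : ν.εreg ≤ B * ε'') (c : Iχ F ν p g k) (W : MSField (F.P p.K) (SU N))
    (_h7 : Sect2.DataSmall7PTop (avOfRecord F N p.K) (maxDomT ν.M₁ (cubeEnl (F.P p.K) (sideχ F ν p g k) c 4))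
      (suppDomOfRecord F ν p.K (maxDomT ν.M₁ (cubeEnl (F.P p.K) (sideχ F ν p g k) c 4))) (k + 1) (fun _ => ε'') W)
    (U₀ : GaugeField (F.P p.K) 0 (SU N))
    (hmin : IsMinimizer (avOfRecord F N p.K) {U | PlaqSmall (ν.εreg * (F.P p.K).eta (k + 1) ^ 2) U}
      (genSet (maxDomT ν.M₁ (cubeEnl (F.P p.K) (sideχ F ν p g k) c 4)) (k + 1)) W U₀) :
    PlaqSmallOn (Sect2.omegaPlaqsTop (maxDomT ν.M₁ (cubeEnl (F.P p.K) (sideχ F ν p g k) c 4))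
        (suppDomOfRecord F ν p.K (maxDomT ν.M₁ (cubeEnl (F.P p.K) (sideχ F ν p g k) c 4))) (k + 1))
      (B * ε'' * (F.P p.K).eta (k + 1) ^ 2) U₀ :=
  fun q _ => lt_of_lt_of_le (hmin.1 q) (mul_le_mul_of_nonneg_right hle (sq_nonneg _))

end Socket

/-! ## §4  The instance and the named Props modulo (W♮) + the K0 socket (T♯) -/

section Instance

variable (F : T4Family) (N : ℕ) [NeZero N] (ν : Stage7Numerics) (M : ℕ) (p : B12.RunParams) (g : ℕ → ℝ) (A₁ : ℝ)

open Classical in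
/-- ★★★ **THE INSTANCE FOR ARBITRARY PINNED FAMILIES BELOW `g⋆`, MODULO (W♮) + (T♯)** — module 55's `…_of_le_gstar_allLayers` with (T♭) REPLACED by the K0 socket (T♯)
«[15] Thm 1 (R) at the top scale for def-R's χ-CLASS local problems, in NODE 00's grammar» (§3) and the three geometric letters (`M₁ ≥ 2`, `L^{j+1}M₁ ∣ 2L^{m+K}`,
`L^{j+1}M₁ ≤ sideχ_j`). [cite: Balaban1989LargeFieldII, (1.79)–(1.80) pp.383–384; Balaban1987RG1, Thm 2 p.259; Balaban1985Variational, (7) p.278, Thm 1 (8) p.279] -/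
theorem sum_admS_integral_le_rec_pinnedLevels_of_le_gstar_chiClassLocal {ρ₀ : cfgOfRecord F N p.K 0 → ℝ}
    (hρ : (bddMeas (cfgOfRecord F N p.K 0)).Gd ρ₀) (h0 : ∀ U, 0 ≤ ρ₀ U) (hM₂ : 0 < ν.M₂)
    (J : Finset ℕ) (hJ : ∀ j ∈ J, j < p.K)
    (D : (j : ℕ) → Finset (Iχ F ν p g j)) {B : ℝ} (hB : 0 < B)
    (hA0 : 0 < ν.A₀) (hp0 : 1 ≤ ν.p₀)
    (hM₁ : 2 ≤ ν.M₁) (hdiv : ∀ j ∈ J, side (F.P p.K).L ν.M₁ (j + 1) ∣ (F.P p.K).sitesPerDir 0)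
    (hsz : ∀ j ∈ J, side (F.P p.K).L ν.M₁ (j + 1) ≤ sideχ F ν p g j)
    (hχ : ∀ j ∈ J, ∀ (c : Iχ F ν p g j) (W : MSField (F.P p.K) (SU N)),
      Sect2.DataSmall7PTop (avOfRecord F N p.K) (maxDomT ν.M₁ (cubeEnl (F.P p.K) (sideχ F ν p g j) c 4))
          (suppDomOfRecord F ν p.K (maxDomT ν.M₁ (cubeEnl (F.P p.K) (sideχ F ν p g j) c 4))) (j + 1) (fun _ => epsOfRecord ν g (j + 1) / B) W →
      ∀ U₀ : GaugeField (F.P p.K) 0 (SU N),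
        IsMinimizer (avOfRecord F N p.K) {U | PlaqSmall (ν.εreg * (F.P p.K).eta (j + 1) ^ 2) U}
            (genSet (maxDomT ν.M₁ (cubeEnl (F.P p.K) (sideχ F ν p g j) c 4)) (j + 1)) W U₀ →
        PlaqSmallOn (Sect2.omegaPlaqsTop (maxDomT ν.M₁ (cubeEnl (F.P p.K) (sideχ F ν p g j) c 4))
            (suppDomOfRecord F ν p.K (maxDomT ν.M₁ (cubeEnl (F.P p.K) (sideχ F ν p g j) c 4))) (j + 1))
          (B * (epsOfRecord ν g (j + 1) / B) * (F.P p.K).eta (j + 1) ^ 2) U₀)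
    {α C a₀ δ : ℝ} (hα : 0 < α)
    (hguard : (((((F.P p.K).d + 2) * (F.P p.K).L : ℕ) : ℝ) ^ 2 / 4) * Real.sqrt (2 * (Fintype.card (Fin N) : ℝ) * α) < deltaSU (Fin N))
    (hC : 0 ≤ C) (hδ : 0 < δ)
    (hδa : δ * ((2 * (Fintype.card (Fin N) : ℝ) * (((F.P p.K).L : ℝ) ^ 2 + 6 * ((((F.P p.K).d + 2) * (F.P p.K).L : ℕ) : ℝ) ^ 2) ^ 2 +
        2 / α) * (((2 * (((F.P p.K).d + 3) * (F.P p.K).L + 2) + 1) ^ (F.P p.K).d * (F.P p.K).d ^ 2 : ℕ) : ℝ)) ≤ a₀)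
    (hgstar : ∀ j ∈ J, 0 < g (j + 1) ∧ g (j + 1) ≤ Real.exp (-(max 1
      ((4 * (Fintype.card (Fin N) : ℝ) * B ^ 2 *
          (C * ((2 * (Fintype.card (Fin N) : ℝ) * (((F.P p.K).L : ℝ) ^ 2 + 6 * ((((F.P p.K).d + 2) * (F.P p.K).L : ℕ) : ℝ) ^ 2) ^ 2 + 2 / α) *
              (((2 * (((F.P p.K).d + 3) * (F.P p.K).L + 2) + 1) ^ (F.P p.K).d * (F.P p.K).d ^ 2 : ℕ) : ℝ)) *
              (((2 * (((F.P p.K).d + 3) * (F.P p.K).L + 2) + 1) ^ (F.P p.K).d * (F.P p.K).d ^ 2 : ℕ) : ℝ) +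
            Real.log (((F.P p.K).d ^ 2 * (9 * (F.P p.K).L * (F.P p.K).L * ν.M₂) ^ (F.P p.K).d : ℕ) : ℝ) / δ) +
        4 * (Fintype.card (Fin N) : ℝ) * B ^ 2 * ((ν.r * (F.P p.K).d : ℕ) : ℝ) / δ) / ν.A₀ ^ 2)) / 2))
    (K' : ℕ) (E : (j : ℕ) → (Fin j → LabelPat F ν p g) → Finset (LbOfRecord F ν p g j)) (hE : ∀ j ∈ J, ∀ h t, t ∈ E j h → D j ⊆ t.1)
    (hW : ∀ j ∈ J, j < K' → ∀ h : Fin j → LabelPat F ν p g,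
      h ∈ admS (labelTowerOfRecord F N ν M p g A₁ (zeta316OfRecord F N ν M A₁)) (labelPattern F ν p g E) j →
      ∀ a : ℝ, 0 ≤ a → a ≤ a₀ → ∀ X : Finset (Plaq (F.P p.K) j),
        (∀ q ∈ X, ∃ c ∈ cubes32 F ν M p g j (seqOfHist F ν M p g j h),
          ∃ p' ∈ (Finset.univ.filter fun q : Plaq (F.P p.K) (j + 1) => embIter (j + 1) q.src ∈ cubeEnl (F.P p.K) (sideχ F ν p g j) c 4),
            q ∈ boxRegion (emb p'.src) (((F.P p.K).d + 3) * (F.P p.K).L + 2)) →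
        ∫ U, Real.exp (a * ((g (j + 1)) ^ 2)⁻¹ * ∑ q ∈ X, (1 - reTr (GaugeField.plaqHol U q))) *
            (labelTowerOfRecord F N ν M p g A₁ (zeta316OfRecord F N ν M A₁)).eterm ρ₀ j h U ∂(lawOfRecord F N p.K j) ≤
          Real.exp (C * a * X.card) * ∫ U, (labelTowerOfRecord F N ν M p g A₁ (zeta316OfRecord F N ν M A₁)).eterm ρ₀ j h U ∂(lawOfRecord F N p.K j)) :
    ∑ h ∈ admS (labelTowerOfRecord F N ν M p g A₁ (zeta316OfRecord F N ν M A₁)) (labelPattern F ν p g E) K',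
        ∫ x, (labelTowerOfRecord F N ν M p g A₁ (zeta316OfRecord F N ν M A₁)).eterm ρ₀ K' h x ∂(lawOfRecord F N p.K K') ≤
      Real.exp (-(δ * (C * ((2 * (Fintype.card (Fin N) : ℝ) * (((F.P p.K).L : ℝ) ^ 2 + 6 * ((((F.P p.K).d + 2) * (F.P p.K).L : ℕ) : ℝ) ^ 2) ^ 2 +
              2 / α) * (((2 * (((F.P p.K).d + 3) * (F.P p.K).L + 2) + 1) ^ (F.P p.K).d * (F.P p.K).d ^ 2 : ℕ) : ℝ)) *
              (((2 * (((F.P p.K).d + 3) * (F.P p.K).L + 2) + 1) ^ (F.P p.K).d * (F.P p.K).d ^ 2 : ℕ) : ℝ))) / (39 : ℝ) ^ (F.P p.K).d *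
          ∑ j ∈ (Finset.range K').filter (· ∈ J), ((D j).card : ℝ)) *
        ∫ U, ρ₀ U ∂(fieldMeasure (F.P p.K) 0 (SU N)) := by
  have hB0 : B ≠ 0 := hB.ne'
  refine sum_admS_integral_le_rec_pinnedLevels_of_le_gstar_allLayers F N ν M p g A₁ hρ h0 hM₂ J hJ D hB hA0 hp0 ?_ hα hguard hC hδ hδa hgstar K' E hE hW
  intro j hj c V' U₀ hmin hall
  have h := hThm1'_of_chiClassLocal F N ν p g hM₁ J hdiv hsz hχ j hj c V' U₀ hmin hall
  rwa [mul_div_cancel₀ _ hB0] at h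

open Classical in
/-- ★★★ **`PointwiseExtraction ∧ LocCondStability` FOR ARBITRARY PINNED FAMILIES BELOW `g⋆`, MODULO (W♮) + (T♯)** — module 55's `halves_of_le_gstar_of_any_allLayers` with (T♭)
REPLACED by the K0 socket (T♯) of §3 and the three geometric letters. [cite: Balaban1989LargeFieldI, (0.3)–(0.5) pp.176–177; Balaban1989LargeFieldII, (1.79)–(1.80) pp.383–384; Balaban1985Variational, (7) p.278, Thm 1 (8) p.279] -/
theorem halves_of_le_gstar_of_any_chiClassLocal {ρ₀ : cfgOfRecord F N p.K 0 → ℝ}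
    (hρ : (bddMeas (cfgOfRecord F N p.K 0)).Gd ρ₀) (h0 : ∀ U, 0 ≤ ρ₀ U) (hM₂ : 0 < ν.M₂)
    (J : Finset ℕ) (hJ : ∀ j ∈ J, j < p.K)
    (D : (j : ℕ) → Finset (Iχ F ν p g j)) {B : ℝ} (hB : 0 < B)
    (hA0 : 0 < ν.A₀) (hp0 : 1 ≤ ν.p₀)
    (hM₁ : 2 ≤ ν.M₁) (hdiv : ∀ j ∈ J, side (F.P p.K).L ν.M₁ (j + 1) ∣ (F.P p.K).sitesPerDir 0)
    (hsz : ∀ j ∈ J, side (F.P p.K).L ν.M₁ (j + 1) ≤ sideχ F ν p g j)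
    (hχ : ∀ j ∈ J, ∀ (c : Iχ F ν p g j) (W : MSField (F.P p.K) (SU N)),
      Sect2.DataSmall7PTop (avOfRecord F N p.K) (maxDomT ν.M₁ (cubeEnl (F.P p.K) (sideχ F ν p g j) c 4))
          (suppDomOfRecord F ν p.K (maxDomT ν.M₁ (cubeEnl (F.P p.K) (sideχ F ν p g j) c 4))) (j + 1) (fun _ => epsOfRecord ν g (j + 1) / B) W →
      ∀ U₀ : GaugeField (F.P p.K) 0 (SU N),
        IsMinimizer (avOfRecord F N p.K) {U | PlaqSmall (ν.εreg * (F.P p.K).eta (j + 1) ^ 2) U}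
            (genSet (maxDomT ν.M₁ (cubeEnl (F.P p.K) (sideχ F ν p g j) c 4)) (j + 1)) W U₀ →
        PlaqSmallOn (Sect2.omegaPlaqsTop (maxDomT ν.M₁ (cubeEnl (F.P p.K) (sideχ F ν p g j) c 4))
            (suppDomOfRecord F ν p.K (maxDomT ν.M₁ (cubeEnl (F.P p.K) (sideχ F ν p g j) c 4))) (j + 1))
          (B * (epsOfRecord ν g (j + 1) / B) * (F.P p.K).eta (j + 1) ^ 2) U₀)
    {α C a₀ δ : ℝ} (hα : 0 < α)
    (hguard : (((((F.P p.K).d + 2) * (F.P p.K).L : ℕ) : ℝ) ^ 2 / 4) * Real.sqrt (2 * (Fintype.card (Fin N) : ℝ) * α) < deltaSU (Fin N))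
    (hC : 0 ≤ C) (hδ : 0 < δ)
    (hδa : δ * ((2 * (Fintype.card (Fin N) : ℝ) * (((F.P p.K).L : ℝ) ^ 2 + 6 * ((((F.P p.K).d + 2) * (F.P p.K).L : ℕ) : ℝ) ^ 2) ^ 2 +
        2 / α) * (((2 * (((F.P p.K).d + 3) * (F.P p.K).L + 2) + 1) ^ (F.P p.K).d * (F.P p.K).d ^ 2 : ℕ) : ℝ)) ≤ a₀)
    (hgstar : ∀ j ∈ J, 0 < g (j + 1) ∧ g (j + 1) ≤ Real.exp (-(max 1
      ((4 * (Fintype.card (Fin N) : ℝ) * B ^ 2 *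
          (C * ((2 * (Fintype.card (Fin N) : ℝ) * (((F.P p.K).L : ℝ) ^ 2 + 6 * ((((F.P p.K).d + 2) * (F.P p.K).L : ℕ) : ℝ) ^ 2) ^ 2 + 2 / α) *
              (((2 * (((F.P p.K).d + 3) * (F.P p.K).L + 2) + 1) ^ (F.P p.K).d * (F.P p.K).d ^ 2 : ℕ) : ℝ)) *
              (((2 * (((F.P p.K).d + 3) * (F.P p.K).L + 2) + 1) ^ (F.P p.K).d * (F.P p.K).d ^ 2 : ℕ) : ℝ) +
            Real.log (((F.P p.K).d ^ 2 * (9 * (F.P p.K).L * (F.P p.K).L * ν.M₂) ^ (F.P p.K).d : ℕ) : ℝ) / δ) +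
        4 * (Fintype.card (Fin N) : ℝ) * B ^ 2 * ((ν.r * (F.P p.K).d : ℕ) : ℝ) / δ) / ν.A₀ ^ 2)) / 2))
    (K' : ℕ) (E : (j : ℕ) → (Fin j → LabelPat F ν p g) → Finset (LbOfRecord F ν p g j)) (hE : ∀ j ∈ J, ∀ h t, t ∈ E j h → D j ⊆ t.1)
    (hW : ∀ j ∈ J, j < K' → ∀ h : Fin j → LabelPat F ν p g,
      h ∈ admS (labelTowerOfRecord F N ν M p g A₁ (zeta316OfRecord F N ν M A₁)) (labelPattern F ν p g E) j →
      ∀ a : ℝ, 0 ≤ a → a ≤ a₀ → ∀ X : Finset (Plaq (F.P p.K) j),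
        (∀ q ∈ X, ∃ c ∈ cubes32 F ν M p g j (seqOfHist F ν M p g j h),
          ∃ p' ∈ (Finset.univ.filter fun q : Plaq (F.P p.K) (j + 1) => embIter (j + 1) q.src ∈ cubeEnl (F.P p.K) (sideχ F ν p g j) c 4),
            q ∈ boxRegion (emb p'.src) (((F.P p.K).d + 3) * (F.P p.K).L + 2)) →
        ∫ U, Real.exp (a * ((g (j + 1)) ^ 2)⁻¹ * ∑ q ∈ X, (1 - reTr (GaugeField.plaqHol U q))) *
            (labelTowerOfRecord F N ν M p g A₁ (zeta316OfRecord F N ν M A₁)).eterm ρ₀ j h U ∂(lawOfRecord F N p.K j) ≤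
          Real.exp (C * a * X.card) * ∫ U, (labelTowerOfRecord F N ν M p g A₁ (zeta316OfRecord F N ν M A₁)).eterm ρ₀ j h U ∂(lawOfRecord F N p.K j)) :
    ∃ D' : (j : ℕ) → Finset (Iχ F ν p g j), (∀ j, D' j ⊆ D j) ∧ (∀ j, (D j).card ≤ 39 ^ (F.P p.K).d * (D' j).card) ∧
      (∀ j, ∀ c₁ ∈ D' j, ∀ c₂ ∈ D' j, c₁ ≠ c₂ → Disjoint
        (Finset.univ.filter fun q : Plaq (F.P p.K) (j + 1) => embIter (j + 1) q.src ∈ cubeEnl (F.P p.K) (sideχ F ν p g j) c₁ 4)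
        (Finset.univ.filter fun q : Plaq (F.P p.K) (j + 1) => embIter (j + 1) q.src ∈ cubeEnl (F.P p.K) (sideχ F ν p g j) c₂ 4)) ∧
      PointwiseExtraction (labelTowerOfRecord F N ν M p g A₁ (zeta316OfRecord F N ν M A₁)) (labelPattern F ν p g E) K'
          (labelChi F N ν M p g A₁ (zeta316OfRecord F N ν M A₁))
          (fun j h U => if j ∈ J then (if D' j ⊆ cubes32 F ν M p g j (seqOfHist F ν M p g j h) then
            Set.indicator {U : cfgOfRecord F N p.K j | ∀ c ∈ D' j, ∃ p' ∈ (Finset.univ.filter fun q : Plaq (F.P p.K) (j + 1) => embIter (j + 1) q.src ∈ cubeEnl (F.P p.K) (sideχ F ν p g j) c 4),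
              epsOfRecord ν g (j + 1) / B ≤ dist1 (GaugeField.plaqHol ((avOfRecord F N p.K j).avg U) p')} (fun _ => (1 : ℝ)) U else 0) else 1)
          (fun _ _ => 0) ∧
      LocCondStability (labelTowerOfRecord F N ν M p g A₁ (zeta316OfRecord F N ν M A₁)) (labelPattern F ν p g E) K' (lawOfRecord F N p.K) ρ₀
          (fun j h U => if j ∈ J then (if D' j ⊆ cubes32 F ν M p g j (seqOfHist F ν M p g j h) then
            Set.indicator {U : cfgOfRecord F N p.K j | ∀ c ∈ D' j, ∃ p' ∈ (Finset.univ.filter fun q : Plaq (F.P p.K) (j + 1) => embIter (j + 1) q.src ∈ cubeEnl (F.P p.K) (sideχ F ν p g j) c 4),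
              epsOfRecord ν g (j + 1) / B ≤ dist1 (GaugeField.plaqHol ((avOfRecord F N p.K j).avg U) p')} (fun _ => (1 : ℝ)) U else 0) else 1)
          (fun j _ => if j ∈ J then Real.log (((((F.P p.K).d ^ 2 * (9 * ((F.P p.K).L * ν.M₂ * RkOfRecord (F.P p.K).L ν.r (g (j + 1)))) ^ (F.P p.K).d : ℕ) : ℝ) * Real.exp (C * ((2 * (Fintype.card (Fin N) : ℝ) * (((F.P p.K).L : ℝ) ^ 2 + 6 * ((((F.P p.K).d + 2) * (F.P p.K).L : ℕ) : ℝ) ^ 2) ^ 2 + 2 / α) * (((2 * (((F.P p.K).d + 3) * (F.P p.K).L + 2) + 1) ^ (F.P p.K).d * (F.P p.K).d ^ 2 : ℕ) : ℝ)) * (((2 * (((F.P p.K).d + 3) * (F.P p.K).L + 2) + 1) ^ (F.P p.K).d * (F.P p.K).d ^ 2 : ℕ) : ℝ) * δ - δ * ((g (j + 1)) ^ 2)⁻¹ * ((epsOfRecord ν g (j + 1) / B) ^ 2 / (2 * (Fintype.card (Fin N) : ℝ))))) ^ (D' j).card) else 0) ∧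
      (∀ j ∈ J, Real.log (((((F.P p.K).d ^ 2 * (9 * ((F.P p.K).L * ν.M₂ * RkOfRecord (F.P p.K).L ν.r (g (j + 1)))) ^ (F.P p.K).d : ℕ) : ℝ) * Real.exp (C * ((2 * (Fintype.card (Fin N) : ℝ) * (((F.P p.K).L : ℝ) ^ 2 + 6 * ((((F.P p.K).d + 2) * (F.P p.K).L : ℕ) : ℝ) ^ 2) ^ 2 + 2 / α) * (((2 * (((F.P p.K).d + 3) * (F.P p.K).L + 2) + 1) ^ (F.P p.K).d * (F.P p.K).d ^ 2 : ℕ) : ℝ)) * (((2 * (((F.P p.K).d + 3) * (F.P p.K).L + 2) + 1) ^ (F.P p.K).d * (F.P p.K).d ^ 2 : ℕ) : ℝ) * δ - δ * ((g (j + 1)) ^ 2)⁻¹ * ((epsOfRecord ν g (j + 1) / B) ^ 2 / (2 * (Fintype.card (Fin N) : ℝ))))) ^ (D' j).card) ≤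
        -(δ * (C * ((2 * (Fintype.card (Fin N) : ℝ) * (((F.P p.K).L : ℝ) ^ 2 + 6 * ((((F.P p.K).d + 2) * (F.P p.K).L : ℕ) : ℝ) ^ 2) ^ 2 + 2 / α) * (((2 * (((F.P p.K).d + 3) * (F.P p.K).L + 2) + 1) ^ (F.P p.K).d * (F.P p.K).d ^ 2 : ℕ) : ℝ)) * (((2 * (((F.P p.K).d + 3) * (F.P p.K).L + 2) + 1) ^ (F.P p.K).d * (F.P p.K).d ^ 2 : ℕ) : ℝ))) * (D' j).card) := by
  have hB0 : B ≠ 0 := hB.ne'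
  refine halves_of_le_gstar_of_any_allLayers F N ν M p g A₁ hρ h0 hM₂ J hJ D hB hA0 hp0 ?_ hα hguard hC hδ hδa hgstar K' E hE hW
  intro j hj c V' U₀ hmin hall
  have h := hThm1'_of_chiClassLocal F N ν p g hM₁ J hdiv hsz hχ j hj c V' U₀ hmin hall
  rwa [mul_div_cancel₀ _ hB0] at h

end Instance

end Summit.QuantumFields.YangMills.BalabanUVNodes.N20LCSChiClassSocket

end
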